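import Summits.AnomalousDissipation.AnomalousDissipation.Theorems.SoloInformedMomentumBalance
import HarnessLib

/-!
# The mean momentum (Euler–Reynolds) equation of a vanishing-viscosity family (solo-informed)

`SoloInformedMomentumBalance` tested the weak formulation of a global Leray–Hopf solution with the
force itself.  Testing it with an ARBITRARY steady smooth divergence-free field `Ψ` on `T^d`
(`Literature.Analysis.FluidPDE.Torus.IsLerayHopfOn.integral_inner_eq_add_setIntegral`) gives

  `(u(t), Ψ) − (u₀, Ψ) = ∫₀ᵗ [ (u ⊗ u : ∇Ψ) + ν (u, ΔΨ) + (f, Ψ) ] ds`,  `(u ⊗ u : ∇Ψ) = ∫⟪u, (u·∇)Ψ⟫`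

(`lerayHopf_testField_identity`).  Consequences (sorry-free, honest Cesàro means):

* `lerayHopf_abs_timeMean_testStress_add_le` — for `ν > 0`, mean-zero `f` and every `T > 0`:
  `|T⁻¹∫₀ᵀ (u ⊗ u : ∇Ψ) + (f, Ψ)| ≤ ν ‖ΔΨ‖₂ (T⁻¹∫₀ᵀ‖u‖₂²)^{1/2} + T⁻¹·C(u₀, Ψ, energy bound)`;
* `lerayHopf_eventually_abs_timeMean_testStress_add_le` — eventually in `T`:
  `|⟨(u ⊗ u : ∇Ψ)⟩_T + (f, Ψ)| ≤ ν ‖ΔΨ‖₂ √(meanEnergy u + δ) + δ` for every `δ > 0`;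
* `meanStress_balance_of_vanishingViscosity` — **the mean Euler–Reynolds equation**: along ANY
  vanishing-viscosity family of global Leray–Hopf solutions driven by ONE fixed smooth
  divergence-free mean-zero force with `⟨‖u_j‖₂²⟩ ≤ E`, for every smooth divergence-free `Ψ` and
  every `δ > 0`, for all large `j`, eventually in `T`: `|⟨(u_j ⊗ u_j : ∇Ψ)⟩_T + (f, Ψ)| ≤ δ`.
  In words: the long-time mean Reynolds stress `R = ⟨u ⊗ u⟩` of the family solves
  `div R + ∇P = f` in the limit `ν → 0`, tested against every smooth solenoidal field — the injected
  momentum is exported from EVERY mode exactly as the force prescribes, with no freedom left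
  (`Ψ = f` is the Reynolds-stress balance law of `SoloInformedMomentumBalance`; `Ψ ⊥ f` forces the
  corresponding stress moments to VANISH in the limit).  For the Kolmogorov force `cos(z) e_x` on
  `T³` this is the statement that the mean shear-stress profile is asymptotically monochromatic,
  `⟨u_x u_z⟩ ∼ −sin z` up to `z`-independent terms, observed in DNS (Musacchio–Boffetta 2014,
  eq. (2.3)–(2.4)) and here a theorem for every bounded-energy Leray–Hopf family;
* `anomalousDissipation_imp_meanMomentumBalance` — every zeroth-law witness obeys it.

References: Doering–Foias, J. Fluid Mech. 467 (2002) §2 [DoeringFoias2002]; Temam,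
*Navier–Stokes Equations* (1984) Ch. III (1.22)–(1.25); Musacchio–Boffetta, Phys. Rev. E 89
(2014) 023004, §2 [arXiv:1401.5935].
-/

noncomputable section

open MeasureTheory Filter Topology Set
open scoped ENNReal NNReal InnerProductSpace RealInnerProductSpace

namespace Summit.AnomalousDissipation.AnomalousDissipation.Theorems

open Literature.Analysis.FunctionSpaces Literature.Analysis.FluidPDE

variable {d : Type*} [Fintype d] [DecidableEq d]

section OneSolution

variable {ν : ℝ} {f u₀ Ψ : UnitAddTorus d → EuclideanSpace ℝ d}
  {u : ℝ → UnitAddTorus d → EuclideanSpace ℝ d}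

/-- **Test-field identity**: for a steady smooth divergence-free `Ψ` and `t > 0`,
`(u(t), Ψ) = (u₀, Ψ) + ∫₀ᵗ [ (u ⊗ u : ∇Ψ) + ν (u, ΔΨ) + (f, Ψ) ] ds` (Temam 1984 Ch. III
(1.22)–(1.25)). [cite: DoeringFoias2002, §2] -/
theorem lerayHopf_testField_identity (hf : Torus.IsSmooth f) (hΨ : Torus.IsSmooth Ψ)
    (hΨdiv : Torus.IsDivFree Ψ) (hu : Torus.IsGlobalLerayHopf ν (fun _ => f) u₀ u) {t : ℝ}
    (ht : 0 < t) :
    ∫ x, ⟪u t x, Ψ x⟫ = (∫ x, ⟪u₀ x, Ψ x⟫) + ∫ s in Ioc 0 t,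
      ∫ x, (⟪u s x, Torus.convect (u s) Ψ x⟫ + ν * ⟪u s x, Torus.laplacian Ψ x⟫ + ⟪f x, Ψ x⟫) :=
  (hu t ht).integral_inner_eq_add_setIntegral ht
    (aestronglyMeasurable_stLift_steady hf.continuous _)
    (lintegral_Ioo_lintegral_enorm_sq_steady_lt_top (hf.memLp 2) t) hΨ hΨdiv ⟨ht, le_rfl⟩

/-- The test flux splits at every time `s ≥ 0` as `(u ⊗ u : ∇Ψ) + ν (u, ΔΨ) + (f, Ψ)`.
[folklore] -/
theorem lerayHopf_testFlux_split (hf : Torus.IsSmooth f) (hΨ : Torus.IsSmooth Ψ)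
    (hu : Torus.IsGlobalLerayHopf ν (fun _ => f) u₀ u) {s : ℝ} (hs : 0 ≤ s) :
    ∫ x, (⟪u s x, Torus.convect (u s) Ψ x⟫ + ν * ⟪u s x, Torus.laplacian Ψ x⟫ + ⟪f x, Ψ x⟫) =
      (∫ x, ⟪u s x, Torus.convect (u s) Ψ x⟫) + ν * (∫ x, ⟪u s x, Torus.laplacian Ψ x⟫)
        + ∫ x, ⟪f x, Ψ x⟫ := by
  have hmem : MemLp (u s) 2 volume := hu.memLp_two hs
  have i1 : Integrable (fun x => ⟪u s x, Torus.convect (u s) Ψ x⟫) volume :=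
    Torus.integrable_inner_convect_self hmem hΨ
  have i2 : Integrable (fun x => ⟪u s x, Torus.laplacian Ψ x⟫) volume :=
    Torus.integrable_inner_of_continuous (hmem.integrable one_le_two) hΨ.laplacian.continuous
  have i3 : Integrable (fun x => ⟪f x, Ψ x⟫) volume :=
    Torus.integrable_inner_of_continuous ((hf.memLp 2).integrable one_le_two) hΨ.continuous
  have i12 : Integrable (fun x => ⟪u s x, Torus.convect (u s) Ψ x⟫
      + ν * ⟪u s x, Torus.laplacian Ψ x⟫) volume := i1.add (i2.const_mul ν)
  rw [integral_add i12 i3, integral_add i1 (i2.const_mul ν), integral_const_mul]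

/-- Interval integrability of the test flux on `[0, T]`. [folklore] -/
theorem lerayHopf_intervalIntegrable_testFlux (hf : Torus.IsSmooth f) (hΨ : Torus.IsSmooth Ψ)
    (hu : Torus.IsGlobalLerayHopf ν (fun _ => f) u₀ u) {T : ℝ} (hT : 0 < T) :
    IntervalIntegrable (fun s => ∫ x, (⟪u s x, Torus.convect (u s) Ψ x⟫
      + ν * ⟪u s x, Torus.laplacian Ψ x⟫ + ⟪f x, Ψ x⟫)) volume 0 T := by
  rw [intervalIntegrable_iff_integrableOn_Ioc_of_le hT.le]
  exact (integrableOn_Ioc_iff_integrableOn_Ioo).mpr ((hu T hT).integrableOn_flux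
    (aestronglyMeasurable_stLift_steady hf.continuous _)
    (lintegral_Ioo_lintegral_enorm_sq_steady_lt_top (hf.memLp 2) T) hΨ)

/-- Interval integrability of the test stress `s ↦ (u ⊗ u : ∇Ψ)`. [folklore] -/
theorem lerayHopf_intervalIntegrable_testStress (hf : Torus.IsSmooth f) (hΨ : Torus.IsSmooth Ψ)
    (hu : Torus.IsGlobalLerayHopf ν (fun _ => f) u₀ u) {T : ℝ} (hT : 0 < T) :
    IntervalIntegrable (fun s => ∫ x, ⟪u s x, Torus.convect (u s) Ψ x⟫) volume 0 T := by
  have hc : IntervalIntegrable (fun _ : ℝ => ∫ x, ⟪f x, Ψ x⟫) volume 0 T :=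
    _root_.intervalIntegrable_const
  refine ((lerayHopf_intervalIntegrable_testFlux hf hΨ hu hT).sub
    (((lerayHopf_intervalIntegrable_inner hu hΨ.laplacian.continuous hT).const_mul ν).add
      hc)).congr fun s hs => ?_
  rw [uIoc_of_le hT.le] at hs
  show (∫ x, (⟪u s x, Torus.convect (u s) Ψ x⟫ + ν * ⟪u s x, Torus.laplacian Ψ x⟫ + ⟪f x, Ψ x⟫))
      - (ν * (∫ x, ⟪u s x, Torus.laplacian Ψ x⟫) + ∫ x, ⟪f x, Ψ x⟫)
      = ∫ x, ⟪u s x, Torus.convect (u s) Ψ x⟫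
  rw [lerayHopf_testFlux_split hf hΨ hu hs.1.le]
  ring

/-- **Cesàro form of the test-field identity**:
`T⁻¹∫₀ᵀ (u ⊗ u : ∇Ψ) + ν T⁻¹∫₀ᵀ (u, ΔΨ) + (f, Ψ) = T⁻¹ [(u(T), Ψ) − (u₀, Ψ)]` for `T > 0`.
[cite: DoeringFoias2002, §2] -/
theorem lerayHopf_timeMean_testStress_eq (hf : Torus.IsSmooth f) (hΨ : Torus.IsSmooth Ψ)
    (hΨdiv : Torus.IsDivFree Ψ) (hu : Torus.IsGlobalLerayHopf ν (fun _ => f) u₀ u) {T : ℝ}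
    (hT : 0 < T) :
    timeMean (fun s => ∫ x, ⟪u s x, Torus.convect (u s) Ψ x⟫) T
        + ν * timeMean (fun s => ∫ x, ⟪u s x, Torus.laplacian Ψ x⟫) T + ∫ x, ⟪f x, Ψ x⟫
      = T⁻¹ * ((∫ x, ⟪u T x, Ψ x⟫) - ∫ x, ⟪u₀ x, Ψ x⟫) := by
  have hid := lerayHopf_testField_identity hf hΨ hΨdiv hu hT
  have hR := lerayHopf_intervalIntegrable_testStress hf hΨ hu hT
  have hL := lerayHopf_intervalIntegrable_inner hu hΨ.laplacian.continuous hT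
  have hEq : EqOn (fun s => ∫ x, (⟪u s x, Torus.convect (u s) Ψ x⟫
      + ν * ⟪u s x, Torus.laplacian Ψ x⟫ + ⟪f x, Ψ x⟫))
      (fun s => (∫ x, ⟪u s x, Torus.convect (u s) Ψ x⟫)
        + ν * (∫ x, ⟪u s x, Torus.laplacian Ψ x⟫) + ∫ x, ⟪f x, Ψ x⟫) (uIcc 0 T) := by
    intro s hs
    rw [uIcc_of_le hT.le] at hs
    exact lerayHopf_testFlux_split hf hΨ hu hs.1
  have hflux : (∫ s in (0:ℝ)..T, ∫ x, (⟪u s x, Torus.convect (u s) Ψ x⟫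
      + ν * ⟪u s x, Torus.laplacian Ψ x⟫ + ⟪f x, Ψ x⟫))
      = (∫ x, ⟪u T x, Ψ x⟫) - ∫ x, ⟪u₀ x, Ψ x⟫ := by
    rw [intervalIntegral.integral_of_le hT.le]
    linarith
  rw [intervalIntegral.integral_congr hEq,
    intervalIntegral.integral_add (hR.add (hL.const_mul ν)) _root_.intervalIntegrable_const,
    intervalIntegral.integral_add hR (hL.const_mul ν), intervalIntegral.integral_const_mul,
    intervalIntegral.integral_const, sub_zero, smul_eq_mul] at hflux
  unfold timeMean
  rw [← hflux]
  field_simp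

/-- **Test-stress balance, finite time**: for `ν ≥ 0` and `T > 0`,
`|T⁻¹∫₀ᵀ (u ⊗ u : ∇Ψ) + (f, Ψ)| ≤ ν ‖ΔΨ‖₂ (T⁻¹∫₀ᵀ ‖u‖₂²)^{1/2} + T⁻¹ |(u(T), Ψ) − (u₀, Ψ)|`.
[cite: DoeringFoias2002, §2] -/
theorem lerayHopf_abs_timeMean_testStress_add_le (hν : 0 ≤ ν) (hf : Torus.IsSmooth f)
    (hΨ : Torus.IsSmooth Ψ) (hΨdiv : Torus.IsDivFree Ψ)
    (hu : Torus.IsGlobalLerayHopf ν (fun _ => f) u₀ u) {T : ℝ} (hT : 0 < T) :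
    |timeMean (fun s => ∫ x, ⟪u s x, Torus.convect (u s) Ψ x⟫) T + ∫ x, ⟪f x, Ψ x⟫| ≤
      ν * Real.sqrt (∫ x, ‖Torus.laplacian Ψ x‖ ^ 2)
          * Real.sqrt (timeMean (fun s => ∫ x, ‖u s x‖ ^ 2) T)
        + T⁻¹ * |(∫ x, ⟪u T x, Ψ x⟫) - ∫ x, ⟪u₀ x, Ψ x⟫| := by
  have heq := lerayHopf_timeMean_testStress_eq hf hΨ hΨdiv hu hT
  have hL := lerayHopf_abs_timeMean_inner_le hu hΨ.laplacian hT
  have h1 : timeMean (fun s => ∫ x, ⟪u s x, Torus.convect (u s) Ψ x⟫) T + ∫ x, ⟪f x, Ψ x⟫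
      = T⁻¹ * ((∫ x, ⟪u T x, Ψ x⟫) - ∫ x, ⟪u₀ x, Ψ x⟫)
        - ν * timeMean (fun s => ∫ x, ⟪u s x, Torus.laplacian Ψ x⟫) T := by linarith
  rw [h1]
  have h2 : |ν * timeMean (fun s => ∫ x, ⟪u s x, Torus.laplacian Ψ x⟫) T|
      ≤ ν * (Real.sqrt (∫ x, ‖Torus.laplacian Ψ x‖ ^ 2)
          * Real.sqrt (timeMean (fun s => ∫ x, ‖u s x‖ ^ 2) T)) := by
    rw [abs_mul, abs_of_nonneg hν]
    exact mul_le_mul_of_nonneg_left hL hν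
  have h3 : |T⁻¹ * ((∫ x, ⟪u T x, Ψ x⟫) - ∫ x, ⟪u₀ x, Ψ x⟫)|
      = T⁻¹ * |(∫ x, ⟪u T x, Ψ x⟫) - ∫ x, ⟪u₀ x, Ψ x⟫| := by
    rw [abs_mul, abs_of_pos (inv_pos.2 hT)]
  calc |T⁻¹ * ((∫ x, ⟪u T x, Ψ x⟫) - ∫ x, ⟪u₀ x, Ψ x⟫)
        - ν * timeMean (fun s => ∫ x, ⟪u s x, Torus.laplacian Ψ x⟫) T|
      ≤ |T⁻¹ * ((∫ x, ⟪u T x, Ψ x⟫) - ∫ x, ⟪u₀ x, Ψ x⟫)|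
        + |ν * timeMean (fun s => ∫ x, ⟪u s x, Torus.laplacian Ψ x⟫) T| := abs_sub _ _
    _ ≤ T⁻¹ * |(∫ x, ⟪u T x, Ψ x⟫) - ∫ x, ⟪u₀ x, Ψ x⟫|
        + ν * (Real.sqrt (∫ x, ‖Torus.laplacian Ψ x‖ ^ 2)
          * Real.sqrt (timeMean (fun s => ∫ x, ‖u s x‖ ^ 2) T)) := by
        rw [h3]; exact add_le_add le_rfl h2
    _ = _ := by ring

/-- **Test-stress balance, long time**: for `ν > 0`, a mean-zero force and every `δ > 0`,
eventually in `T`: `|⟨(u ⊗ u : ∇Ψ)⟩_T + (f, Ψ)| ≤ ν ‖ΔΨ‖₂ √(meanEnergy u + δ) + δ`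
(the boundary term is bounded because the energy is; the Cesàro energy is eventually below
`limsup + δ`). [cite: DoeringFoias2002, §2] -/
theorem lerayHopf_eventually_abs_timeMean_testStress_add_le (hν : 0 < ν) (hf : Torus.IsSmooth f)
    (hmean : Torus.HasZeroMean f) (hΨ : Torus.IsSmooth Ψ) (hΨdiv : Torus.IsDivFree Ψ)
    (hu : Torus.IsGlobalLerayHopf ν (fun _ => f) u₀ u) {δ : ℝ} (hδ : 0 < δ) :
    ∀ᶠ T in atTop,
      |timeMean (fun s => ∫ x, ⟪u s x, Torus.convect (u s) Ψ x⟫) T + ∫ x, ⟪f x, Ψ x⟫| ≤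
        ν * Real.sqrt (∫ x, ‖Torus.laplacian Ψ x‖ ^ 2) * Real.sqrt (meanEnergy u + δ) + δ := by
  obtain ⟨R, hR⟩ := hu.exists_forall_integral_norm_sq_le_of_hasZeroMean hν (hf.memLp 2) hmean
  obtain ⟨C, hC0, hbdry⟩ : ∃ C : ℝ, 0 ≤ C ∧
      ∀ T, 0 < T → |(∫ x, ⟪u T x, Ψ x⟫) - ∫ x, ⟪u₀ x, Ψ x⟫| ≤ C := by
    refine ⟨Real.sqrt (max R 0) * Real.sqrt (∫ x, ‖Ψ x‖ ^ 2) + |∫ x, ⟪u₀ x, Ψ x⟫|,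
      by positivity, fun T hT => ?_⟩
    have h1 : |∫ x, ⟪u T x, Ψ x⟫| ≤ Real.sqrt (max R 0) * Real.sqrt (∫ x, ‖Ψ x‖ ^ 2) :=
      (abs_integral_inner_le_sqrt_mul_sqrt (hu.memLp_two hT.le) (hΨ.memLp 2)).trans
        (mul_le_mul_of_nonneg_right (Real.sqrt_le_sqrt ((hR T hT.le).trans (le_max_left _ _)))
          (Real.sqrt_nonneg _))
    exact (abs_sub _ _).trans (add_le_add h1 le_rfl)
  have hbddE : IsBoundedUnder (· ≤ ·) atTop (timeMean fun s => ∫ x, ‖u s x‖ ^ 2) :=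
    hu.isBoundedUnder_timeMean_energy hν (hf.memLp 2) hmean
  have hEev : ∀ᶠ T in atTop, timeMean (fun s => ∫ x, ‖u s x‖ ^ 2) T < meanEnergy u + δ := by
    have hlt : limsup (timeMean fun s => ∫ x, ‖u s x‖ ^ 2) atTop < meanEnergy u + δ := by
      rw [show meanEnergy u = limsup (timeMean fun s => ∫ x, ‖u s x‖ ^ 2) atTop from rfl]
      linarith
    exact eventually_lt_of_limsup_lt hlt hbddE
  have hTev : ∀ᶠ T : ℝ in atTop, T⁻¹ * C ≤ δ := by
    filter_upwards [eventually_gt_atTop 0, eventually_ge_atTop (C / δ)] with T hT0 hTδ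
    rw [inv_mul_le_iff₀ hT0]
    exact (div_le_iff₀ hδ).1 hTδ
  filter_upwards [eventually_gt_atTop 0, hEev, hTev] with T hT hE hTC
  have hmain := lerayHopf_abs_timeMean_testStress_add_le hν.le hf hΨ hΨdiv hu hT
  have hA0 : 0 ≤ ν * Real.sqrt (∫ x, ‖Torus.laplacian Ψ x‖ ^ 2) :=
    mul_nonneg hν.le (Real.sqrt_nonneg _)
  have h1 : ν * Real.sqrt (∫ x, ‖Torus.laplacian Ψ x‖ ^ 2)
        * Real.sqrt (timeMean (fun s => ∫ x, ‖u s x‖ ^ 2) T)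
      ≤ ν * Real.sqrt (∫ x, ‖Torus.laplacian Ψ x‖ ^ 2) * Real.sqrt (meanEnergy u + δ) :=
    mul_le_mul_of_nonneg_left (Real.sqrt_le_sqrt hE.le) hA0
  have h2 : T⁻¹ * |(∫ x, ⟪u T x, Ψ x⟫) - ∫ x, ⟪u₀ x, Ψ x⟫| ≤ δ :=
    (mul_le_mul_of_nonneg_left (hbdry T hT) (inv_nonneg.2 hT.le)).trans hTC
  linarith

end OneSolution

/-- **The mean Euler–Reynolds equation of a vanishing-viscosity family.**  Along any family of
global Leray–Hopf solutions driven by ONE fixed steady smooth divergence-free mean-zero force `f`,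
with `ν_j → 0` and `⟨‖u_j‖₂²⟩ ≤ E`, the long-time mean Reynolds stress balances the force in EVERY
smooth solenoidal direction: for every smooth divergence-free `Ψ` and `δ > 0`, for all large `j`,
eventually in `T`, `|⟨(u_j ⊗ u_j : ∇Ψ)⟩_T + (f, Ψ)| ≤ δ` — i.e. `div ⟨u ⊗ u⟩ + ∇P = f` in the
limit, weakly.  [cite: DoeringFoias2002, §2] -/
theorem meanStress_balance_of_vanishingViscosity {f : UnitAddTorus d → EuclideanSpace ℝ d}
    (hf : Torus.IsSmooth f) (hmean : Torus.HasZeroMean f) {ν : ℕ → ℝ}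
    {u₀ : ℕ → UnitAddTorus d → EuclideanSpace ℝ d}
    {u : ℕ → ℝ → UnitAddTorus d → EuclideanSpace ℝ d} (hν : ∀ j, 0 < ν j)
    (hν0 : Tendsto ν atTop (𝓝 0))
    (hLH : ∀ j, Torus.IsGlobalLerayHopf (ν j) (fun _ => f) (u₀ j) (u j)) {E : ℝ}
    (hE : ∀ j, meanEnergy (u j) ≤ E) {Ψ : UnitAddTorus d → EuclideanSpace ℝ d}
    (hΨ : Torus.IsSmooth Ψ) (hΨdiv : Torus.IsDivFree Ψ) {δ : ℝ} (hδ : 0 < δ) :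
    ∀ᶠ j in atTop, ∀ᶠ T in atTop,
      |timeMean (fun s => ∫ x, ⟪u j s x, Torus.convect (u j s) Ψ x⟫) T + ∫ x, ⟪f x, Ψ x⟫| ≤ δ := by
  have hE0 : 0 ≤ E := (meanEnergy_nonneg (u 0)).trans (hE 0)
  set A : ℝ := Real.sqrt (∫ x, ‖Torus.laplacian Ψ x‖ ^ 2) * Real.sqrt (E + δ / 2) with hA
  have hlim : Tendsto (fun j => ν j * A) atTop (𝓝 0) := by simpa using hν0.mul_const A
  have hjev : ∀ᶠ j in atTop, ν j * A < δ / 2 := (tendsto_order.1 hlim).2 _ (half_pos hδ)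
  filter_upwards [hjev] with j hj
  filter_upwards [lerayHopf_eventually_abs_timeMean_testStress_add_le (hν j) hf hmean hΨ hΨdiv
    (hLH j) (half_pos hδ)] with T hT
  have h1 : ν j * Real.sqrt (∫ x, ‖Torus.laplacian Ψ x‖ ^ 2) * Real.sqrt (meanEnergy (u j) + δ / 2)
      ≤ ν j * A := by
    rw [hA, ← mul_assoc]
    exact mul_le_mul_of_nonneg_left (Real.sqrt_le_sqrt (by linarith [hE j]))
      (mul_nonneg (hν j).le (Real.sqrt_nonneg _))
  linarith

/-- **Every zeroth-law witness obeys the mean Euler–Reynolds equation**: its long-time mean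
Reynolds stresses export the injected momentum from every solenoidal mode exactly as `f`
prescribes (`Ψ = f`: the stress against `∇f` tends to `−‖f‖₂²`; `Ψ ⊥ f`: the stress moment
against `∇Ψ` vanishes in the limit). [cite: DoeringFoias2002, §2] -/
theorem anomalousDissipation_imp_meanMomentumBalance (h : _root_.AnomalousDissipation) :
    ∃ (f : UnitAddTorus (Fin 3) → EuclideanSpace ℝ (Fin 3)) (ν : ℕ → ℝ)
      (u : ℕ → ℝ → UnitAddTorus (Fin 3) → EuclideanSpace ℝ (Fin 3)) (E : ℝ),
      Torus.IsSmooth f ∧ Torus.IsDivFree f ∧ Torus.HasZeroMean f ∧ (∀ j, 0 < ν j) ∧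
        Tendsto ν atTop (𝓝 0) ∧ (∀ j, meanEnergy (u j) ≤ E) ∧
        (∃ ε : ℝ, 0 < ε ∧ ∀ j, ε ≤ meanDissipation (ν j) (u j)) ∧
        ∀ (Ψ : UnitAddTorus (Fin 3) → EuclideanSpace ℝ (Fin 3)),
          Torus.IsSmooth Ψ → Torus.IsDivFree Ψ → ∀ δ : ℝ, 0 < δ →
            ∀ᶠ j in atTop, ∀ᶠ T in atTop,
              |timeMean (fun s => ∫ x, ⟪u j s x, Torus.convect (u j s) Ψ x⟫) T
                + ∫ x, ⟪f x, Ψ x⟫| ≤ δ := by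
  obtain ⟨f, hf, hdiv, hmean, ν, u₀, u, hν, hν0, hLH, ⟨E, hE⟩, ε, hε, hεle⟩ := h
  exact ⟨f, ν, u, E, hf, hdiv, hmean, hν, hν0, hE, ⟨ε, hε, hεle⟩, fun Ψ hΨ hΨdiv δ hδ =>
    meanStress_balance_of_vanishingViscosity hf hmean hν hν0 hLH hE hΨ hΨdiv hδ⟩

end Summit.AnomalousDissipation.AnomalousDissipation.Theorems

end
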